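import Summits.Ventures.HSemireg.WedgeHankelRecurrenceGaussLaguerreDifferentialEquation

/-!
# Venture HSemireg — **THE GEGENBAUER ∕ LEGENDRE CALIBRATION OF WALL–WETZEL**: the monic ultraspherical recurrence `a ≡ 0`, `b_n = n(n + 2λ − 1) ∕ (4(n+λ)(n+λ−1))` (`λ > 0`) has the EXPLICIT
# chain parameters `g_n = n ∕ (2(n+λ))` at both end points `±1` — `b_{n+1} = (1 − g_n) g_{n+1}` — so ALL ZEROS OF `C^{(λ)}_{t+1}` LIE IN `(−1, 1)` (N372), they are symmetric (`x_k = −x_{t−k}`, `Σ x_k = 0`,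
# N340) and `Σ x_k² = 2 Σ_{n ≤ t} b_n`; LEGENDRE is `λ = ½` (`b_n = n²∕(4n² − 1)`, `g_n = n∕(2n+1)`) and CHEBYSHEV-`U` is `λ = 1` (`b_n = 1∕4`, `g_n = n∕(2n+2)`)

HONEST FRAMING. Part of the Lean index of the computation cell `pub-hsemireg` (seat p10 gen 46, Sunday typer «UNIFORM-IN-n»).  Real polynomials and finite sums only; no variety, no cohomology theory,
no sheaf, no Ext group and no semiregularity map is constructed here; nothing here says that HC / HC_CM / HC_AV holds; no Literature fact (unproved `Prop`) is declared or used.  Custodian versions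
as in `WedgeHankelSiegelIdeal` (1/3).
SOURCES (cited).  G. Szegő, *Orthogonal Polynomials*, (4.7.17) (the ultraspherical recurrence), §6.21 (zeros in `(−1, 1)`), (4.5.x) Legendre; T. S. Chihara, *An Introduction to Orthogonal Polynomials*
(1978), Ch. V §2 (C), Ch. III §5–IV §2 (the chain sequence of the Jacobi recurrence at `±1`); M. E. H. Ismail, *Classical and Quantum Orthogonal Polynomials* (2005), §4.5, Thm 7.2.1;
H. S. Wall, M. Wetzel, Duke Math. J. 11 (1944).
PROOF TYPED HERE.  `(1 − n∕(2(n+λ))) · (n+1)∕(2(n+1+λ)) = (n+1)(n+2λ) ∕ (4(n+λ)(n+λ+1)) = b_{n+1}`; N372 `zeros_lt_of_chain` (`B = 1`) and `zeros_gt_of_chain` (`A = −1`) with `a ≡ 0`; N340 for the symmetry;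
N298 `sum_recurrence_zeros_sq`.
DEDUP DISCLOSURE (`rg -n -i 'gegenbauer|ultraspher|legendre' Summits/Ventures/HSemireg`, 2026-09-03): `HodgeRepro2` has a Legendre toolkit (`legP`, Turán, Bonnet) for other purposes; this chapter
had no Legendre ∕ Gegenbauer recurrence.  The 4 names below: 0 hits tree-wide.

WHAT IS IN THE TREE.  N372 `zeros_lt_of_chain`, `zeros_gt_of_chain`; N340 `symmetric_recurrence_zeros_symm`; N298 `sum_recurrence_zeros_sq`; N279 `recurrence_zeros_interlace`.
THIS FILE (namespace `Summit.Ventures.HSemireg.Wedge.HankelOuter` continued; CHAINED on N389 (import only); 0 definitions):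
* §1155 `gegenbauer_chain_identity` (`b_{n+1} = (1 − g_n) g_{n+1}`), **`gegenbauer_zeros_mem`** (zeros in `(−1, 1)`, `λ > 0`), **`gegenbauer_zeros`** (increasing symmetric zeros, product form,
  `Σ x = 0`, `Σ x² = 2 Σ b`), **`legendre_zeros_mem`** (`b_n = n²∕(4n²−1)`: zeros in `(−1, 1)`).
CAVEATS.  `λ > 0` (the range `−½ < λ ≤ 0` needs a separate sign discussion of `b_1`); recurrence-only (no Rodrigues formula or weight).  Nothing Ext-side.  New names only.
-/

open Module Polynomial
open scoped Matrix Polynomial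

namespace Summit.Ventures.HSemireg.Wedge.HankelOuter

/-! ## §1155. Gegenbauer and Legendre zeros via chain sequences -/

/-- **The ultraspherical chain identity: `(1 − n∕(2(n+λ))) · (n+1)∕(2(n+1+λ)) = (n+1)(n+2λ)∕(4(n+1+λ)(n+λ))`** (`λ > 0`). [Chihara III §5; this file, §1155] -/
theorem gegenbauer_chain_identity {lam : ℝ} (hlam : 0 < lam) (n : ℕ) :
    (1 - (n : ℝ) / (2 * ((n : ℝ) + lam))) * (((n : ℝ) + 1) / (2 * ((n : ℝ) + 1 + lam))) = ((n : ℝ) + 1) * ((n : ℝ) + 2 * lam) / (4 * ((n : ℝ) + 1 + lam) * ((n : ℝ) + lam)) := by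
  have h0 : (0 : ℝ) ≤ n := Nat.cast_nonneg n
  have h1 : 2 * ((n : ℝ) + lam) ≠ 0 := by positivity
  have h2 : 2 * ((n : ℝ) + 1 + lam) ≠ 0 := by positivity
  field_simp
  ring

/-- **GEGENBAUER ZEROS LIE IN `(−1, 1)`** (`λ > 0`; recurrence `a ≡ 0`, `b_{n+1} = (n+1)(n+2λ)∕(4(n+1+λ)(n+λ))`, any positive `b_0`). [Szegő §6.21; Wall–Wetzel via N372; this file, §1155] -/
theorem gegenbauer_zeros_mem {q : ℕ → ℝ[X]} {a b : ℕ → ℝ} {lam : ℝ} (hq0 : q 0 = 1) (hq1 : q 1 = Polynomial.X - C (a 0))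
    (hrec : ∀ n, q (n + 2) = (Polynomial.X - C (a (n + 1))) * q (n + 1) - C (b (n + 1)) * q n) (ha : ∀ n, a n = 0)
    (hb : ∀ n, b (n + 1) = ((n : ℝ) + 1) * ((n : ℝ) + 2 * lam) / (4 * ((n : ℝ) + 1 + lam) * ((n : ℝ) + lam))) (hlam : 0 < lam) (hb0 : 0 < b 0) (t : ℕ) :
    ∀ s, (q (t + 1)).eval s = 0 → -1 < s ∧ s < 1 := by
  have hbpos : ∀ j, 0 < b j := fun j => by
    rcases j with _ | n
    · exact hb0
    · rw [hb]; have h0 : (0 : ℝ) ≤ n := Nat.cast_nonneg n; positivity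
  have hg : ∀ n : ℕ, n ≤ t → 0 ≤ (n : ℝ) / (2 * ((n : ℝ) + lam)) ∧ (n : ℝ) / (2 * ((n : ℝ) + lam)) < 1 := fun n _ => by
    have h0 : (0 : ℝ) ≤ n := Nat.cast_nonneg n
    exact ⟨by positivity, (div_lt_one (by positivity)).2 (by linarith)⟩
  have hcmp : ∀ n : ℕ, n + 1 ≤ t → b (n + 1) ≤ (1 - (n : ℝ) / (2 * ((n : ℝ) + lam))) * ((((n + 1 : ℕ) : ℝ)) / (2 * ((((n + 1 : ℕ) : ℝ)) + lam))) * 1 := fun n _ => by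
    push_cast
    rw [gegenbauer_chain_identity hlam n, hb, mul_one]
  intro s hs
  constructor
  · refine zeros_gt_of_chain hq0 hq1 hrec hbpos (A := -1) (g := fun n => (n : ℝ) / (2 * ((n : ℝ) + lam))) (fun n _ => by rw [ha]; norm_num) hg (fun n hn => ?_) s hs
    rw [ha, ha, show ((0 : ℝ) - -1) * (0 - -1) = 1 by norm_num]; exact hcmp n hn
  · refine zeros_lt_of_chain hq0 hq1 hrec hbpos (B := 1) (g := fun n => (n : ℝ) / (2 * ((n : ℝ) + lam))) (fun n _ => by rw [ha]; norm_num) hg (fun n hn => ?_) s hs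
    rw [ha, ha, show ((1 : ℝ) - 0) * (1 - 0) = 1 by norm_num]; exact hcmp n hn

/-- **THE GEGENBAUER ZEROS: `t + 1` increasing symmetric zeros in `(−1, 1)`, `Σ x_k = 0`, `Σ x_k² = 2 Σ_{n<t} b_{n+1}`** (for `t ≥ 1`). [Szegő §6.21, (4.7.17); this file, §1155] -/
theorem gegenbauer_zeros {q : ℕ → ℝ[X]} {a b : ℕ → ℝ} {lam : ℝ} (hq0 : q 0 = 1) (hq1 : q 1 = Polynomial.X - C (a 0))
    (hrec : ∀ n, q (n + 2) = (Polynomial.X - C (a (n + 1))) * q (n + 1) - C (b (n + 1)) * q n) (ha : ∀ n, a n = 0)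
    (hb : ∀ n, b (n + 1) = ((n : ℝ) + 1) * ((n : ℝ) + 2 * lam) / (4 * ((n : ℝ) + 1 + lam) * ((n : ℝ) + lam))) (hlam : 0 < lam) (hb0 : 0 < b 0) (m : ℕ) :
    ∃ x : Fin (m + 2) → ℝ, StrictMono x ∧ q (m + 2) = ∏ k, (Polynomial.X - C (x k)) ∧ (∀ k, -1 < x k ∧ x k < 1) ∧ (∀ k, x k = -x (Fin.rev k)) ∧ ∑ k, x k = 0 ∧
      ∑ k, x k ^ 2 = 2 * ∑ i ∈ Finset.range (m + 1), b (i + 1) := by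
  have hbpos : ∀ j, 0 < b j := fun j => by
    rcases j with _ | n
    · exact hb0
    · rw [hb]; have h0 : (0 : ℝ) ≤ n := Nat.cast_nonneg n; positivity
  obtain ⟨x, -, hx, -, hxq, -, -⟩ := recurrence_zeros_interlace hq0 hq1 hrec hbpos (m + 1)
  have hmem := gegenbauer_zeros_mem hq0 hq1 hrec ha hb hlam hb0 (m + 1)
  obtain ⟨hsymm, hsum⟩ := symmetric_recurrence_zeros_symm hq0 hq1 hrec ha hx hxq
  refine ⟨x, hx, hxq, fun k => hmem _ (by rw [hxq, eval_prod]; exact Finset.prod_eq_zero (Finset.mem_univ k) (by simp)), hsymm, hsum, ?_⟩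
  rw [sum_recurrence_zeros_sq hq0 hq1 hrec hxq, Finset.sum_eq_zero fun i _ => by rw [ha, zero_pow two_ne_zero], zero_add]

/-- **LEGENDRE (`λ = ½`): the recurrence `a ≡ 0`, `b_n = n² ∕ (4n² − 1)` has all zeros of `P_{t+1}` in `(−1, 1)`** — chain parameters `g_n = n∕(2n+1)`. [Szegő (4.5.x), §6.21; this file, §1155] -/
theorem legendre_zeros_mem {q : ℕ → ℝ[X]} {a b : ℕ → ℝ} (hq0 : q 0 = 1) (hq1 : q 1 = Polynomial.X - C (a 0))
    (hrec : ∀ n, q (n + 2) = (Polynomial.X - C (a (n + 1))) * q (n + 1) - C (b (n + 1)) * q n) (ha : ∀ n, a n = 0)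
    (hb : ∀ n, b (n + 1) = ((n : ℝ) + 1) ^ 2 / (4 * ((n : ℝ) + 1) ^ 2 - 1)) (hb0 : 0 < b 0) (t : ℕ) : ∀ s, (q (t + 1)).eval s = 0 → -1 < s ∧ s < 1 := by
  refine gegenbauer_zeros_mem hq0 hq1 hrec ha (lam := 1 / 2) (fun n => ?_) (by norm_num) hb0 t
  rw [hb]
  have h0 : (0 : ℝ) ≤ n := Nat.cast_nonneg n
  have h1 : 4 * ((n : ℝ) + 1) ^ 2 - 1 ≠ 0 := by nlinarith
  have h2 : 4 * ((n : ℝ) + 1 + 1 / 2) * ((n : ℝ) + 1 / 2) ≠ 0 := by positivity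
  rw [div_eq_div_iff h1 h2]
  ring

end Summit.Ventures.HSemireg.Wedge.HankelOuter
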